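import Summits.HodgeConjecture.HodgeConjecture.Theses.HCCMUnconditional
import HarnessLib

/-!
# Route `HCCMUnconditional`, item `Assembly` (stmt-HodgeConjecture-24839) — PROVED

Cell `hodgecm-mathlib` (D-0151 release track, ladder HODGECM-MATHLIB rung 0).  The route's assembly decl
`Summit.HodgeConjecture.HodgeConjecture.Theses.HCCMUnconditional.Assembly` is by definition the implication
`HDel → H21 → HLiu418 → H413 → H411 → HD3 → HD1pp → RankFourFaces.CMAbelianHodge`, i.e. exactly the type of the
route's deciding theorem `HCCMUnconditional.closes` (the kernel certificate
`PrintedCitationHypotheses.hc_cm_of_hyps`, p588166, composed with `HC_CM = RankFourFaces.CMAbelianHodge`).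
§1 `Assembly_proof` records this (imports: the route file only).  §2 (appended below §1 in this file) feeds the same
composition with the closing theorems of the items already CLOSED — `H411_proof` (stmt-24836), `HD3_proof` (stmt-24837),
`HD1pp_proof` (stmt-24838) — so that HC_CM is displayed from exactly the route items still OPEN.

STATUS theorems, not discharges: HC_CM is proved only modulo the 7 printed citations until rung 0 closes (after
`h411`, `hD1''`, `hD3`: four binders remain — `hDel`, `h21`, `hLiu418`, `h413`).  For the floor in NAMED FACTS
(items replaced by their residual Literature facts) see `hc_cm_of_facts` / `hc_cm_of_facts'`
(`HCCMUnconditionalOfFacts.lean`).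

## References
* [Liu2021] Y. Liu, Camb. J. Math. 9 (2021) = arXiv:2102.11518: Thm. 4.18, Prop. 4.13, Def. 4.11, App. D Lem. D.1.
* [Shimura1998] G. Shimura, *Abelian Varieties with Complex Multiplication and Modular Functions*, Thm. 21.4.
* [Deligne1979ShimuraVarieties] P. Deligne, Variétés de Shimura, 2.2.5, Cor. 2.7.21.
-/

set_option autoImplicit false

-- mandated namespace `Summit.HodgeConjecture.HodgeConjecture.Theorems` (single-problem summit) trips `linter.dupNamespace`;
-- the lakefile turns it off tree-wide, restated here so stand-alone elaboration is warning-free (as in `HCCMUnconditionalH411.lean`).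
set_option linter.dupNamespace false

namespace Summit.HodgeConjecture.HodgeConjecture.Theorems

/-- **§1 Item `Assembly` of route `HCCMUnconditional`, PROVED**: the seven crux statements `HDel`, `H21`, `HLiu418`, `H413`,
`H411`, `HD3`, `HD1pp` imply HC_CM (`RankFourFaces.CMAbelianHodge`) — literally the route's deciding theorem `closes`
(= `PrintedCitationHypotheses.hc_cm_of_hyps`, the headline `hc_cm_of_printed_citations_muKey_ident_lemD3_delRecConjOmegaT`
applied at `(hLiu418 hDel) … (hD1pp hDel)`).  HC_CM is proved only modulo the 7 printed citations until rung 0 closes.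
[cite: Liu2021, Thm. 4.18; Prop. 4.13; Def. 4.11; App. D Lem. D.1] [cite: Shimura1998, Thm. 21.4]
[cite: Deligne1979ShimuraVarieties, 2.2.5 and Cor. 2.7.21] -/
theorem Assembly_proof : Summit.HodgeConjecture.HodgeConjecture.Theses.HCCMUnconditional.Assembly := by
  unfold Summit.HodgeConjecture.HodgeConjecture.Theses.HCCMUnconditional.Assembly
  exact Summit.HodgeConjecture.HodgeConjecture.Theses.HCCMUnconditional.closes

end Summit.HodgeConjecture.HodgeConjecture.Theorems
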